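import Summits.Ventures.YMGap.Thresholds.ZeroCouplingKernelAllGroups
import Literature.MathematicalPhysics.QuantumFieldTheory.LatticeGaugeShenZhuZhuProofs
import Literature.Probability.LatticeModels.GibbsStrongMarkov
import HarnessLib

/-!
# First-order strong-coupling perturbation theory for EVERY local observable and EVERY gauge group, uniformly over ALL
# DLR states; all DLR states are `O(β)`-close to the infinite Haar product; `𝒢(0) = {dg_∞}` (row type C-SLOPE-0-G, part 3)

Cell `pub-ymgap`, seat ds-1 (gen 15). HONEST FRAMING: exact LATTICE statements at the strong-coupling END POINT `β = 0` of the
Wilson action `β Σ_p (N − Re tr ρ(U_p))` on `ℤ^d`, for an ARBITRARY compact metrisable gauge group `G`, arbitrary continuous `ρ`,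
every `d`, both signs of `β`; explicit remainders UNIFORM OVER ALL DLR STATES (no uniqueness, no window, no cluster expansion).
Generality/exactness, not a threshold; nothing about weak coupling, the continuum, or Clay. Kernel theorems, 0 defs, 0 compute.

## Contents

1. `abs_integral_tilted_sub_le`: first-order bound for Gibbs reweightings, `|∫F d(P.tilted(−βH)) − ∫F dP| ≤ 2 C B |β|`.
2. ★★ ZEROTH ORDER (`abs_integral_sub_integral_zdHaar_le`, `exists_forall_abs_integral_sub_integral_zdHaar_le`): for every bounded
   continuous cylinder observable `F` (support `Λ`), EVERY `β`, EVERY `ν ∈ 𝒢(β)`: `|∫F dν − ∫F d(dg_∞)| ≤ 2 C (N + M) #P(Λ) |β|` —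
   ALL DLR states are `O(β)`-close to the infinite Haar product `dg_∞` on local observables; ★ `ymGibbsMeasures_zero_eq`: `𝒢(0) = {dg_∞}`.
3. ★★★ FIRST ORDER (`abs_integral_sub_taylor_zdHaar_le`, `exists_forall_abs_integral_sub_taylor_le`):
   `|∫F dν − ∫F d(dg_∞) + β · Cov_{dg_∞}(F, S_Λ)| ≤ K_F β²` for EVERY `β` and EVERY `ν ∈ 𝒢(β)` — first-order strong-coupling
   perturbation theory holds uniformly over all DLR states, for every local observable and every compact gauge group (DLR at `Λ`,
   part 1's `η`-uniform kernel expansion, item 2 applied to the kernel covariance — a bounded continuous cylinder of the boundary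
   condition —, and the resampling identity `integral_integral_pi_glueWith_zdHaar`).
4. ★ FLUCTUATION–RESPONSE AT `β = 0` (`hasDerivAt_integral_cylinder_zero`, `…_sum`, `cov_wilsonBoundaryAction_zdHaar_eq_sum`): along
   ANY family of DLR states, `d/dβ|₀ ∫F dν_β = −Cov_{dg_∞}(F, S_Λ) = Σ_{p ∩ Λ ≠ ∅} Cov_{dg_∞}(F, Re tr ρ(U_p))`.

References (mechanism): H.-O. Georgii, *Gibbs Measures and Phase Transitions* (2011) Rem. 1.24; B. Simon, *The Statistical Mechanics
of Lattice Gases* I (1993) §II.1; R. Balian, J.-M. Drouffe, C. Itzykson, PRD 11 (1975) 2104 §III (strong-coupling expansion).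
-/

noncomputable section

open MeasureTheory ProbabilityTheory Set Filter Topology Finset
open scoped NNReal
open Literature.Probability.LatticeModels (glueWith IsGibbsMeasure IsSpecification measurable_glueWith)
open Literature.MathematicalPhysics.QuantumLattice (LGConfig ZdEdge ZdPlaquette ymGibbsMeasures ymSpecification plaquetteObs
  plaquetteEdges plaquettesTouching plaquetteHolonomyZd wilsonBoundaryAction IsCylinder continuous_plaquetteObs
  continuous_wilsonBoundaryAction measurable_glueWith_prod integrable_of_bound exists_bound_of_continuous
  continuous_integral_ymSpecification abs_integral_ymSpecification_le glueWith_congr_of_eqOn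
  isCylinder_wilsonBoundaryAction_holds integrableExpSet_eq_univ_of_abs_le hasDerivAt_integral_tilted_neg)
open Literature.MathematicalPhysics.QuantumFieldTheory hiding ZdEdge

namespace Summit.Ventures.YMGap.ZeroCouplingSlope

/-! ## 1. First-order bound for Gibbs reweightings -/

section Tilted

variable {Ω : Type*} {mΩ : MeasurableSpace Ω} {P : Measure Ω} [IsProbabilityMeasure P] {F H : Ω → ℝ} {B C : ℝ}

/-- **First-order bound for Gibbs reweightings**: for a probability measure `P`, a measurable energy `|H| ≤ B` and a measurable
observable `|F| ≤ C`, `|∫F d(P.tilted(−βH)) − ∫F dP| ≤ 2 C B |β|` for every real `β` (Feynman–Hellmann: the derivative is minus a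
reweighted covariance, bounded by `2 C B`; mean value inequality). [folklore] -/
theorem abs_integral_tilted_sub_le (hF : Measurable F) (hC : ∀ ω, |F ω| ≤ C) (hH : Measurable H) (hB : ∀ ω, |H ω| ≤ B) (β : ℝ) :
    |(∫ ω, F ω ∂(P.tilted fun ω => -β * H ω)) - ∫ ω, F ω ∂P| ≤ 2 * C * B * |β| := by
  have hint : ∀ b : ℝ, -b ∈ interior (integrableExpSet H P) := fun b => by
    rw [integrableExpSet_eq_univ_of_abs_le hH.aemeasurable (ae_of_all _ hB), interior_univ]; exact mem_univ _
  have hCn : ∀ᵐ ω ∂P, ‖F ω‖ ≤ C := ae_of_all _ fun ω => by simpa [Real.norm_eq_abs] using hC ω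
  obtain ⟨ω₀⟩ := nonempty_of_isProbabilityMeasure P
  have hC0 : 0 ≤ C := (abs_nonneg _).trans (hC ω₀)
  have hFH : ∀ ω, |F ω * H ω| ≤ C * B := fun ω => (abs_mul _ _).trans_le (mul_le_mul (hC ω) (hB ω) (abs_nonneg _) hC0)
  set Φ : ℝ → ℝ := fun b => ∫ ω, F ω ∂(P.tilted fun ω => -b * H ω) with hΦ
  set M : ℝ → ℝ := fun b => (∫ ω, F ω * H ω ∂(P.tilted fun ω => -b * H ω)) -
    (∫ ω, F ω ∂(P.tilted fun ω => -b * H ω)) * ∫ ω, H ω ∂(P.tilted fun ω => -b * H ω) with hM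
  have hΦ' : ∀ b, HasDerivAt Φ (-M b) b := fun b => by
    simpa [hΦ, hM] using hasDerivAt_integral_tilted_neg (μ := P) (F := F) (H := H) (C := C) (hint b) hF.aestronglyMeasurable hCn
  have hMb : ∀ b, |(-M b)| ≤ 2 * C * B := fun b => by
    rw [abs_neg, hM]
    have e1 := abs_integral_tilted_le (P := P) hH hB hFH b
    have e2 := abs_integral_tilted_le (P := P) hH hB hC b
    have e3 := abs_integral_tilted_le (P := P) hH hB hB b
    have e23 := (abs_mul _ _).trans_le (mul_le_mul e2 e3 (abs_nonneg _) hC0)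
    have := abs_sub (∫ ω, F ω * H ω ∂(P.tilted fun ω => -b * H ω))
      ((∫ ω, F ω ∂(P.tilted fun ω => -b * H ω)) * ∫ ω, H ω ∂(P.tilted fun ω => -b * H ω))
    linarith
  have h := Convex.norm_image_sub_le_of_norm_hasDerivWithin_le (f := Φ) (f' := fun b => -M b) (s := univ)
    (fun x _ => (hΦ' x).hasDerivWithinAt) (fun x _ => by simpa only [Real.norm_eq_abs] using hMb x) convex_univ (mem_univ 0)
    (mem_univ β)
  have hΦ0 : Φ 0 = ∫ ω, F ω ∂P := by
    simp only [hΦ]; rw [show (fun ω => -(0:ℝ) * H ω) = (0 : Ω → ℝ) from funext fun _ => by simp, tilted_zero]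
  rw [Real.norm_eq_abs, Real.norm_eq_abs, sub_zero, hΦ0] at h
  exact h

end Tilted

/-! ## 2. Zeroth order: all DLR states are `O(β)`-close to the infinite Haar product on cylinders -/

section Cylinder

variable {d N : ℕ} {G : Type*} [Group G] [TopologicalSpace G] [IsTopologicalGroup G] [CompactSpace G]
  [MeasurableSpace G] [BorelSpace G] [SecondCountableTopology G] [T2Space G] (ρ : G →* Matrix (Fin N) (Fin N) ℂ)

omit [SecondCountableTopology G] [T2Space G] in
/-- At `β = 0` the kernel expectation of a `Λ`-cylinder observable is its `dg_∞`-mean, for EVERY boundary condition. [folklore] -/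
theorem integral_pi_glueWith_of_isCylinder {Λ : Finset (ZdEdge d)} {F : LGConfig d G → ℝ} (hFΛ : IsCylinder F Λ)
    (hFm : Measurable F) (η : LGConfig d G) :
    ∫ U, F U ∂((Measure.pi fun _ : ↥Λ => haarProbability G).map (glueWith Λ · η)) = ∫ U, F U ∂(zdHaar d G) := by
  rw [integral_pi_glueWith_eq_integral_zdHaar Λ η hFm]
  exact integral_congr_ae (ae_of_all _ fun U => apply_glueWith_restrict_of_isCylinder hFΛ U η)

/-- ★★ **Zeroth order, every cylinder, every DLR state, every compact gauge group.** For continuous `ρ` with `|Re tr ρ| ≤ M`,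
a bounded continuous cylinder observable `F` (support `Λ`, `|F| ≤ C`), EVERY `β ∈ ℝ` and EVERY `ν ∈ 𝒢(β)`:
`|∫F dν − ∫F d(dg_∞)| ≤ 2 C ((N + M) #plaquettesTouching Λ) |β|` — the DLR equation at `Λ` and the first-order kernel bound,
the `β = 0` kernel mean of `F` being `∫F d(dg_∞)` for every boundary condition. [folklore] -/
theorem abs_integral_sub_integral_zdHaar_le (hρ : Continuous ρ) {M : ℝ} (hM : ∀ g : G, |(ρ g).trace.re| ≤ M)
    {Λ : Finset (ZdEdge d)} {F : LGConfig d G → ℝ} (hFΛ : IsCylinder F Λ) (hFc : Continuous F) {C : ℝ} (hC : ∀ U, |F U| ≤ C)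
    (β : ℝ) {ν : Measure (LGConfig d G)} (hν : ν ∈ ymGibbsMeasures (d := d) ρ β) :
    |(∫ U, F U ∂ν) - ∫ U, F U ∂(zdHaar d G)| ≤ 2 * C * (((N : ℝ) + M) * (plaquettesTouching Λ).card) * |β| := by
  classical
  set c : ℝ := ∫ U, F U ∂(zdHaar d G) with hc
  set K : ℝ := 2 * C * (((N : ℝ) + M) * (plaquettesTouching Λ).card) * |β| with hK
  have hFm : Measurable F := hFc.measurable
  have hWm : Measurable (wilsonBoundaryAction (G := G) ρ Λ) := (continuous_wilsonBoundaryAction ρ hρ Λ).measurable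
  have hWB : ∀ U : LGConfig d G, |wilsonBoundaryAction ρ Λ U| ≤ ((N : ℝ) + M) * (plaquettesTouching Λ).card :=
    fun U => abs_wilsonBoundaryAction_le_card ρ hM Λ U
  have hker : ∀ η : LGConfig d G, |(∫ U, F U ∂(ymSpecification ρ β Λ η)) - c| ≤ K := by
    intro η
    haveI : IsProbabilityMeasure ((Measure.pi fun _ : ↥Λ => haarProbability G).map (glueWith Λ · η)) :=
      isProbabilityMeasure_pi_glueWith Λ η
    have h := abs_integral_tilted_sub_le (P := (Measure.pi fun _ : ↥Λ => haarProbability G).map (glueWith Λ · η))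
      hFm hC hWm hWB β
    rwa [integral_pi_glueWith_of_isCylinder hFΛ hFm η] at h
  have hγ : IsSpecification (ymSpecification (d := d) ρ β) := isSpecification_ymSpecification_of_t2Space ρ hρ β
  have hνG : IsGibbsMeasure (ymSpecification (d := d) ρ β) ν := hν; haveI : IsProbabilityMeasure ν := hνG.isProbabilityMeasure
  have hDLR : ∫ η, (∫ U, F U ∂(ymSpecification ρ β Λ η)) ∂ν = ∫ U, F U ∂ν := by
    simpa only [Measure.restrict_univ] using hνG.setIntegral_integral_spec hγ Λ (B := Set.univ) MeasurableSet.univ hFm hC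
  have hint : Integrable (fun η => ∫ U, F U ∂(ymSpecification ρ β Λ η)) ν := integrable_of_bound
    (continuous_integral_ymSpecification ρ hρ β Λ hFc hC).aestronglyMeasurable (abs_integral_ymSpecification_le ρ hρ β Λ hC)
  rw [show (∫ U, F U ∂ν) - c = ∫ η, ((∫ U, F U ∂(ymSpecification ρ β Λ η)) - c) ∂ν by
    rw [integral_sub hint (integrable_const _), integral_const, probReal_univ, one_smul, hDLR]]
  have h := norm_integral_le_of_norm_le_const (μ := ν) (C := K) (f := fun η => (∫ U, F U ∂(ymSpecification ρ β Λ η)) - c)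
    (ae_of_all _ fun η => by simpa only [Real.norm_eq_abs] using hker η)
  rw [probReal_univ, mul_one] at h; simpa only [Real.norm_eq_abs] using h

/-- ★★ **Constant-free form of the zeroth order**: for a bounded continuous cylinder observable `F` there is `K` with
`|∫F dν − ∫F d(dg_∞)| ≤ K |β|` for EVERY `β` and EVERY `ν ∈ 𝒢(β)` — as `β → 0`, ALL DLR states converge to the infinite Haar
product on local observables, at a linear rate, for every compact gauge group. [folklore] -/
theorem exists_forall_abs_integral_sub_integral_zdHaar_le (hρ : Continuous ρ) {Λ : Finset (ZdEdge d)} {F : LGConfig d G → ℝ}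
    (hFΛ : IsCylinder F Λ) (hFc : Continuous F) :
    ∃ K : ℝ, ∀ (β : ℝ) (ν : Measure (LGConfig d G)), ν ∈ ymGibbsMeasures (d := d) ρ β →
      |(∫ U, F U ∂ν) - ∫ U, F U ∂(zdHaar d G)| ≤ K * |β| := by
  obtain ⟨M, -, hM⟩ := exists_bound_trace_re_nonneg ρ hρ
  obtain ⟨C, hC⟩ := exists_bound_of_continuous hFc
  exact ⟨_, fun β ν hν => abs_integral_sub_integral_zdHaar_le ρ hρ hM hFΛ hFc hC β hν⟩

/-- ★ **`𝒢(0) = {dg_∞}` for every compact metrisable gauge group, every `ρ`, every `d`**: at `β = 0` the infinite product of Haar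
measures is THE ONLY DLR state (item 2 at `β = 0` on every bounded continuous cylinder, which determine the measure —
`measure_eq_of_integral_cylinder_eq`; membership is gen 9's `zdHaar_mem_ymGibbsMeasures_zero`). [folklore] -/
theorem ymGibbsMeasures_zero_eq (hρ : Continuous ρ) : ymGibbsMeasures (d := d) ρ 0 = {zdHaar d G} := by
  refine Set.eq_singleton_iff_unique_mem.2 ⟨PressureRegularity.zdHaar_mem_ymGibbsMeasures_zero ρ, fun ν hν => ?_⟩
  have hνG : IsGibbsMeasure (ymSpecification (d := d) ρ 0) ν := hν
  haveI : IsProbabilityMeasure ν := hνG.isProbabilityMeasure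
  refine measure_eq_of_integral_cylinder_eq fun F S hFS hFc _ => ?_
  obtain ⟨K, hK⟩ := exists_forall_abs_integral_sub_integral_zdHaar_le ρ hρ hFS hFc
  simpa [abs_nonpos_iff, sub_eq_zero] using hK 0 ν hν

/-! ## 3. First order: every continuous cylinder observable, uniformly over all DLR states -/

omit [SecondCountableTopology G] [T2Space G] in
/-- **The resampling identity, integral form**: `∫ (∫ h(ζ η_{Λᶜ}) dζ) d(dg_∞)(η) = ∫ h d(dg_∞)` for bounded measurable `h`
(`map_glueWith_zdHaar_prod_pi`: a `dg_∞`-sample with its `Λ`-part replaced by an independent Haar sample is a `dg_∞`-sample).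
[folklore] -/
theorem integral_integral_pi_glueWith_zdHaar (Λ : Finset (ZdEdge d)) {h : LGConfig d G → ℝ} (hm : Measurable h) {C : ℝ}
    (hC : ∀ U, |h U| ≤ C) :
    ∫ η, (∫ U, h U ∂((Measure.pi fun _ : ↥Λ => haarProbability G).map (glueWith Λ · η))) ∂(zdHaar d G) =
      ∫ U, h U ∂(zdHaar d G) := by
  have hg : Measurable fun p : LGConfig d G × (↥Λ → G) => glueWith Λ p.2 p.1 := measurable_glueWith_prod Λ
  have h1 : ∀ η : LGConfig d G, ∫ U, h U ∂((Measure.pi fun _ : ↥Λ => haarProbability G).map (glueWith Λ · η)) =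
      ∫ ζ, h (glueWith Λ ζ η) ∂(Measure.pi fun _ : ↥Λ => haarProbability G) := fun η =>
    integral_map (measurable_glueWith Λ η).aemeasurable hm.aestronglyMeasurable
  simp_rw [h1]
  have hint : Integrable (fun p : LGConfig d G × (↥Λ → G) => h (glueWith Λ p.2 p.1))
      ((zdHaar d G).prod (Measure.pi fun _ : ↥Λ => haarProbability G)) :=
    integrable_of_bound (hm.comp hg).aestronglyMeasurable fun p => hC _
  rw [← integral_prod _ hint, ← integral_map hg.aemeasurable hm.aestronglyMeasurable, map_glueWith_zdHaar_prod_pi]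

/-- ★★★ **First-order strong-coupling perturbation theory for EVERY local observable, uniformly over ALL DLR states, every compact
gauge group.** For continuous `ρ` with `|Re tr ρ| ≤ M`, a bounded continuous cylinder observable `F` (support `Λ`, `|F| ≤ C`),
EVERY `β ∈ ℝ` and EVERY `ν ∈ 𝒢(β)`, with `S_Λ` the boundary Wilson action of `Λ` and `B = (N + M) #plaquettesTouching Λ`:
`|∫F dν − ∫F d(dg_∞) + β · Cov_{dg_∞}(F, S_Λ)| ≤ (6 C B² + 2 (2 C B) ((N + M) #plaquettesTouching Λ')) β²`,
`Λ' = Λ ∪ ⋃_{p ∩ Λ ≠ ∅} edges(p)`. Proof: DLR at `Λ`; part 1's `η`-uniform second-order expansion of the kernel, whose zeroth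
coefficient is `∫F d(dg_∞)` for every `η` and whose first coefficient — the `β = 0` kernel covariance `K(η)` of `F` with `S_Λ` — is a
bounded continuous cylinder observable of the boundary condition with support `Λ'`; item 2 applied to `K`; and
`∫ K d(dg_∞) = Cov_{dg_∞}(F, S_Λ)` by the resampling identity. [folklore] -/
theorem abs_integral_sub_taylor_zdHaar_le (hρ : Continuous ρ) {M : ℝ} (hM : ∀ g : G, |(ρ g).trace.re| ≤ M)
    {Λ : Finset (ZdEdge d)} {F : LGConfig d G → ℝ} (hFΛ : IsCylinder F Λ) (hFc : Continuous F) {C : ℝ} (hC : ∀ U, |F U| ≤ C)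
    (β : ℝ) {ν : Measure (LGConfig d G)} (hν : ν ∈ ymGibbsMeasures (d := d) ρ β) :
    |(∫ U, F U ∂ν) - (∫ U, F U ∂(zdHaar d G)) +
        β * ((∫ U, F U * wilsonBoundaryAction ρ Λ U ∂(zdHaar d G)) -
          (∫ U, F U ∂(zdHaar d G)) * ∫ U, wilsonBoundaryAction ρ Λ U ∂(zdHaar d G))| ≤
      (6 * C * (((N : ℝ) + M) * (plaquettesTouching Λ).card) ^ 2 +
        2 * (2 * C * (((N : ℝ) + M) * (plaquettesTouching Λ).card)) *
          (((N : ℝ) + M) * (plaquettesTouching (Λ ∪ (plaquettesTouching Λ).biUnion plaquetteEdges)).card)) * β ^ 2 := by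
  classical
  set T : Finset (ZdEdge d) := Λ ∪ (plaquettesTouching Λ).biUnion plaquetteEdges with hT
  set B : ℝ := ((N : ℝ) + M) * (plaquettesTouching Λ).card with hB
  set B' : ℝ := ((N : ℝ) + M) * (plaquettesTouching T).card with hB'
  set c : ℝ := ∫ U, F U ∂(zdHaar d G) with hc
  set W : LGConfig d G → ℝ := wilsonBoundaryAction ρ Λ with hW
  set π : LGConfig d G → Measure (LGConfig d G) := fun η =>
    (Measure.pi fun _ : ↥Λ => haarProbability G).map (glueWith Λ · η) with hπ
  set K : LGConfig d G → ℝ := fun η => (∫ U, F U * W U ∂(π η)) - (∫ U, F U ∂(π η)) * ∫ U, W U ∂(π η) with hK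
  have hFm : Measurable F := hFc.measurable
  have hWc : Continuous W := continuous_wilsonBoundaryAction ρ hρ Λ
  have hWm : Measurable W := hWc.measurable
  have hWB : ∀ U : LGConfig d G, |W U| ≤ B := fun U => abs_wilsonBoundaryAction_le_card ρ hM Λ U
  have hC0 : 0 ≤ C := (abs_nonneg _).trans (hC fun _ => 1)
  have hFW : ∀ U, |F U * W U| ≤ C * B := fun U => (abs_mul _ _).trans_le (mul_le_mul (hC U) (hWB U) (abs_nonneg _) hC0)
  have hπ0 : ∀ η, π η = ymSpecification ρ 0 Λ η := fun η => (PressureRegularity.ymSpecification_zero_apply ρ Λ η).symm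
  haveI hπP : ∀ η, IsProbabilityMeasure (π η) := fun η => isProbabilityMeasure_pi_glueWith Λ η
  have hcη : ∀ η, (∫ U, F U ∂(π η)) = c := fun η => integral_pi_glueWith_of_isCylinder hFΛ hFm η
  -- Step 1: the `η`-uniform second-order kernel expansion (part 1), zeroth coefficient `c`
  have hker : ∀ η : LGConfig d G, |(∫ U, F U ∂(ymSpecification ρ β Λ η)) - c + β * K η| ≤ 6 * C * B ^ 2 * β ^ 2 := by
    intro η
    have h := abs_integral_tilted_taylor_two_le (P := π η) hFm hC hWm hWB β
    rw [hcη η] at h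
    have e : (∫ U, F U ∂(ymSpecification ρ β Λ η)) - c + β * K η = (∫ U, F U ∂((π η).tilted fun U => -β * W U)) - c +
        β * ((∫ U, F U * W U ∂(π η)) - c * ∫ U, W U ∂(π η)) := by simp only [hK]; rw [hcη η]; rfl
    rw [e]; exact h
  -- Step 2: `K` is a bounded continuous `T`-cylinder observable of the boundary condition
  have hKc : Continuous K := by
    have e : K = fun η => (∫ U, F U * W U ∂(ymSpecification ρ 0 Λ η)) -
        (∫ U, F U ∂(ymSpecification ρ 0 Λ η)) * ∫ U, W U ∂(ymSpecification ρ 0 Λ η) := by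
      funext η; simp only [hK, hπ0]
    rw [e]
    exact (continuous_integral_ymSpecification ρ hρ 0 Λ (hFc.mul hWc) hFW).sub
      ((continuous_integral_ymSpecification ρ hρ 0 Λ hFc hC).mul (continuous_integral_ymSpecification ρ hρ 0 Λ hWc hWB))
  have hKb : ∀ η, |K η| ≤ 2 * C * B := fun η => by
    have e1 : |∫ U, F U * W U ∂(π η)| ≤ C * B := by simpa using abs_integral_tilted_le (P := π η) hWm hWB hFW 0
    have e2 : |∫ U, F U ∂(π η)| ≤ C := by simpa using abs_integral_tilted_le (P := π η) hWm hWB hC 0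
    have e3 : |∫ U, W U ∂(π η)| ≤ B := by simpa using abs_integral_tilted_le (P := π η) hWm hWB hWB 0
    have e23 := (abs_mul _ _).trans_le (mul_le_mul e2 e3 (abs_nonneg _) hC0)
    have := abs_sub (∫ U, F U * W U ∂(π η)) ((∫ U, F U ∂(π η)) * ∫ U, W U ∂(π η))
    simp only [hK]; linarith
  have hKcyl : IsCylinder K T := by
    intro η η' hηη'
    have hWcyl := isCylinder_wilsonBoundaryAction_holds (G := G) ρ Λ
    have hg : ∀ (ζ : ↥Λ → G) (e : ZdEdge d), e ∈ T → glueWith Λ ζ η e = glueWith Λ ζ η' e := fun ζ e he =>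
      glueWith_congr_of_eqOn (fun e he => hηη' e (Finset.mem_coe.2 he)) ζ he
    have hF' : ∀ ζ : ↥Λ → G, F (glueWith Λ ζ η) = F (glueWith Λ ζ η') := fun ζ =>
      hFΛ fun e he => hg ζ e (Finset.mem_union_left _ (Finset.mem_coe.1 he))
    have hW' : ∀ ζ : ↥Λ → G, W (glueWith Λ ζ η) = W (glueWith Λ ζ η') := fun ζ =>
      hWcyl fun e he => hg ζ e (Finset.mem_union_right _ (Finset.mem_coe.1 he))
    have hi : ∀ {h : LGConfig d G → ℝ}, Measurable h → (∀ ζ : ↥Λ → G, h (glueWith Λ ζ η) = h (glueWith Λ ζ η')) →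
        ∫ U, h U ∂(π η) = ∫ U, h U ∂(π η') := fun hm hh => by
      simp only [hπ]
      rw [integral_map (measurable_glueWith Λ η).aemeasurable hm.aestronglyMeasurable,
        integral_map (measurable_glueWith Λ η').aemeasurable hm.aestronglyMeasurable]
      exact integral_congr_ae (ae_of_all _ hh)
    show (∫ U, F U * W U ∂(π η)) - (∫ U, F U ∂(π η)) * ∫ U, W U ∂(π η) =
      (∫ U, F U * W U ∂(π η')) - (∫ U, F U ∂(π η')) * ∫ U, W U ∂(π η')
    rw [hi (h := fun U => F U * W U) (hFm.mul hWm) fun ζ => by rw [hF', hW'], hi hFm hF', hi hWm hW']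
  -- Step 3: zeroth order for `K`
  have hK0 : |(∫ η, K η ∂ν) - ∫ η, K η ∂(zdHaar d G)| ≤ 2 * (2 * C * B) * B' * |β| :=
    abs_integral_sub_integral_zdHaar_le ρ hρ hM hKcyl hKc hKb β hν
  -- Step 4: `∫ K d(dg_∞) = Cov_{dg_∞}(F, S_Λ)` (resampling identity)
  have hKZ : ∫ η, K η ∂(zdHaar d G) = (∫ U, F U * W U ∂(zdHaar d G)) - c * ∫ U, W U ∂(zdHaar d G) := by
    have e : K = fun η => (∫ U, F U * W U ∂(π η)) - c * ∫ U, W U ∂(π η) := by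
      funext η; simp only [hK]; rw [hcη η]
    rw [e]
    have i1 : Integrable (fun η => ∫ U, F U * W U ∂(π η)) (zdHaar d G) := by
      refine integrable_of_bound ?_ (C := C * B) fun η => ?_
      · have hc' := continuous_integral_ymSpecification ρ hρ 0 Λ (hFc.mul hWc) hFW
        simp only [← hπ0] at hc'; exact hc'.aestronglyMeasurable
      · simpa using abs_integral_tilted_le (P := π η) hWm hWB hFW 0
    have i2 : Integrable (fun η => ∫ U, W U ∂(π η)) (zdHaar d G) := by
      refine integrable_of_bound ?_ (C := B) fun η => ?_
      · have hc' := continuous_integral_ymSpecification ρ hρ 0 Λ hWc hWB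
        simp only [← hπ0] at hc'; exact hc'.aestronglyMeasurable
      · simpa using abs_integral_tilted_le (P := π η) hWm hWB hWB 0
    rw [integral_sub i1 (i2.const_mul c), integral_const_mul]
    simp only [hπ]
    rw [integral_integral_pi_glueWith_zdHaar Λ (h := fun U => F U * W U) (hFm.mul hWm) hFW,
      integral_integral_pi_glueWith_zdHaar Λ hWm hWB]
  -- Step 5: DLR and assembly
  have hγ : IsSpecification (ymSpecification (d := d) ρ β) := isSpecification_ymSpecification_of_t2Space ρ hρ β
  have hνG : IsGibbsMeasure (ymSpecification (d := d) ρ β) ν := hν; haveI : IsProbabilityMeasure ν := hνG.isProbabilityMeasure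
  have hDLR : ∫ η, (∫ U, F U ∂(ymSpecification ρ β Λ η)) ∂ν = ∫ U, F U ∂ν := by
    simpa only [Measure.restrict_univ] using hνG.setIntegral_integral_spec hγ Λ (B := Set.univ) MeasurableSet.univ hFm hC
  have hint : Integrable (fun η => ∫ U, F U ∂(ymSpecification ρ β Λ η)) ν := integrable_of_bound
    (continuous_integral_ymSpecification ρ hρ β Λ hFc hC).aestronglyMeasurable (abs_integral_ymSpecification_le ρ hρ β Λ hC)
  have hKint : Integrable K ν := integrable_of_bound hKc.aestronglyMeasurable hKb
  have hsplit : (∫ U, F U ∂ν) - c + β * ((∫ U, F U * W U ∂(zdHaar d G)) - c * ∫ U, W U ∂(zdHaar d G)) =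
      (∫ η, ((∫ U, F U ∂(ymSpecification ρ β Λ η)) - c + β * K η) ∂ν) -
        β * ((∫ η, K η ∂ν) - ∫ η, K η ∂(zdHaar d G)) := by
    have hA : Integrable (fun η => (∫ U, F U ∂(ymSpecification ρ β Λ η)) - c) ν := hint.sub (integrable_const _)
    have hB2 : Integrable (fun η => β * K η) ν := hKint.const_mul β
    rw [integral_add hA hB2, integral_sub hint (integrable_const _), integral_const_mul, integral_const, probReal_univ,
      one_smul, hDLR, hKZ]
    ring
  rw [hsplit]
  have h1 : |∫ η, ((∫ U, F U ∂(ymSpecification ρ β Λ η)) - c + β * K η) ∂ν| ≤ 6 * C * B ^ 2 * β ^ 2 := by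
    have h := norm_integral_le_of_norm_le_const (μ := ν) (f := fun η => (∫ U, F U ∂(ymSpecification ρ β Λ η)) - c + β * K η)
      (ae_of_all _ fun η => by simpa only [Real.norm_eq_abs] using hker η)
    rw [probReal_univ, mul_one] at h; simpa only [Real.norm_eq_abs] using h
  have h2 : |β * ((∫ η, K η ∂ν) - ∫ η, K η ∂(zdHaar d G))| ≤ 2 * (2 * C * B) * B' * β ^ 2 := by
    rw [abs_mul, show 2 * (2 * C * B) * B' * β ^ 2 = |β| * (2 * (2 * C * B) * B' * |β|) by rw [← sq_abs β]; ring]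
    exact mul_le_mul_of_nonneg_left hK0 (abs_nonneg _)
  calc _ ≤ |∫ η, ((∫ U, F U ∂(ymSpecification ρ β Λ η)) - c + β * K η) ∂ν| +
        |β * ((∫ η, K η ∂ν) - ∫ η, K η ∂(zdHaar d G))| := abs_sub _ _
    _ ≤ 6 * C * B ^ 2 * β ^ 2 + 2 * (2 * C * B) * B' * β ^ 2 := add_le_add h1 h2
    _ = _ := by simp only [hB, hB', hT]; ring

/-- ★★★ **Constant-free form**: for a bounded continuous cylinder observable `F` with support `Λ` there is `K` such that for EVERY
`β ∈ ℝ` and EVERY `ν ∈ 𝒢(β)`, `|∫F dν − ∫F d(dg_∞) + β · Cov_{dg_∞}(F, S_Λ)| ≤ K β²`. [folklore] -/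
theorem exists_forall_abs_integral_sub_taylor_le (hρ : Continuous ρ) {Λ : Finset (ZdEdge d)} {F : LGConfig d G → ℝ}
    (hFΛ : IsCylinder F Λ) (hFc : Continuous F) :
    ∃ K : ℝ, ∀ (β : ℝ) (ν : Measure (LGConfig d G)), ν ∈ ymGibbsMeasures (d := d) ρ β →
      |(∫ U, F U ∂ν) - (∫ U, F U ∂(zdHaar d G)) +
          β * ((∫ U, F U * wilsonBoundaryAction ρ Λ U ∂(zdHaar d G)) -
            (∫ U, F U ∂(zdHaar d G)) * ∫ U, wilsonBoundaryAction ρ Λ U ∂(zdHaar d G))| ≤ K * β ^ 2 := by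
  obtain ⟨M, -, hM⟩ := exists_bound_trace_re_nonneg ρ hρ
  obtain ⟨C, hC⟩ := exists_bound_of_continuous hFc
  exact ⟨_, fun β ν hν => abs_integral_sub_taylor_zdHaar_le ρ hρ hM hFΛ hFc hC β hν⟩

/-! ## 4. Fluctuation–response at `β = 0` for every local observable and every gauge group -/

/-- ★ **Fluctuation–response at `β = 0`, every local observable, every compact gauge group**: along ANY family of DLR states
`β ↦ ν_β ∈ 𝒢(β)` (near `0`), `β ↦ ∫F dν_β` is differentiable at `β = 0` with derivative `−Cov_{dg_∞}(F, S_Λ)` — no uniqueness,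
continuity or selection hypothesis (the `O(β²)` remainder is uniform over the DLR states). [folklore] -/
theorem hasDerivAt_integral_cylinder_zero (hρ : Continuous ρ) {Λ : Finset (ZdEdge d)} {F : LGConfig d G → ℝ}
    (hFΛ : IsCylinder F Λ) (hFc : Continuous F) {ν : ℝ → Measure (LGConfig d G)}
    (hν : ∀ᶠ β in 𝓝 0, ν β ∈ ymGibbsMeasures (d := d) ρ β) :
    HasDerivAt (fun β => ∫ U, F U ∂(ν β))
      (-((∫ U, F U * wilsonBoundaryAction ρ Λ U ∂(zdHaar d G)) -
        (∫ U, F U ∂(zdHaar d G)) * ∫ U, wilsonBoundaryAction ρ Λ U ∂(zdHaar d G))) 0 := by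
  obtain ⟨K, hK⟩ := exists_forall_abs_integral_sub_taylor_le ρ hρ hFΛ hFc
  set D : ℝ := (∫ U, F U * wilsonBoundaryAction ρ Λ U ∂(zdHaar d G)) -
    (∫ U, F U ∂(zdHaar d G)) * ∫ U, wilsonBoundaryAction ρ Λ U ∂(zdHaar d G) with hD
  have h0 : ∫ U, F U ∂(ν 0) = ∫ U, F U ∂(zdHaar d G) := by
    simpa [abs_nonpos_iff, sub_eq_zero] using hK 0 (ν 0) hν.self_of_nhds
  rw [hasDerivAt_iff_isLittleO]
  simp only [sub_zero, h0]
  have h1 : (fun β => (∫ U, F U ∂(ν β)) - (∫ U, F U ∂(zdHaar d G)) - β • (-D)) =O[𝓝 0] fun β => β ^ 2 := by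
    refine Asymptotics.IsBigO.of_bound K ?_
    filter_upwards [hν] with β hβ
    rw [Real.norm_eq_abs, Real.norm_eq_abs, abs_pow, sq_abs, smul_eq_mul, show (∫ U, F U ∂(ν β)) -
      (∫ U, F U ∂(zdHaar d G)) - β * -D = (∫ U, F U ∂(ν β)) - (∫ U, F U ∂(zdHaar d G)) + β * D by ring]
    exact hK β (ν β) hβ
  exact h1.trans_isLittleO (Asymptotics.isLittleO_pow_id one_lt_two)

omit [T2Space G] in
/-- **The response coefficient as a finite plaquette sum**: `−Cov_{dg_∞}(F, S_Λ) = Σ_{p ∩ Λ ≠ ∅} Cov_{dg_∞}(F, Re tr ρ(U_p))`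
(`S_Λ = Σ_{p ∩ Λ ≠ ∅} (N − Re tr ρ(U_p))`; constants have no covariance). [folklore] -/
theorem cov_wilsonBoundaryAction_zdHaar_eq_sum (hρ : Continuous ρ) (Λ : Finset (ZdEdge d)) {F : LGConfig d G → ℝ}
    (hFc : Continuous F) :
    -((∫ U, F U * wilsonBoundaryAction ρ Λ U ∂(zdHaar d G)) -
        (∫ U, F U ∂(zdHaar d G)) * ∫ U, wilsonBoundaryAction ρ Λ U ∂(zdHaar d G)) =
      ∑ p ∈ plaquettesTouching Λ, ((∫ U, F U * plaquetteObs ρ p.1 p.2.1.1 p.2.1.2 U ∂(zdHaar d G)) -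
        (∫ U, F U ∂(zdHaar d G)) * ∫ U, plaquetteObs ρ p.1 p.2.1.1 p.2.1.2 U ∂(zdHaar d G)) := by
  classical
  have hobs : ∀ p : ZdPlaquette d, Continuous (plaquetteObs (G := G) ρ p.1 p.2.1.1 p.2.1.2) := fun p =>
    continuous_plaquetteObs ρ hρ _ _ _
  have hI : ∀ {g : LGConfig d G → ℝ}, Continuous g → Integrable g (zdHaar d G) := fun hg =>
    AreaLaw.integrable_zdHaar_of_continuous hg
  have hW : ∀ U : LGConfig d G, wilsonBoundaryAction ρ Λ U =
      ∑ p ∈ plaquettesTouching Λ, ((N : ℝ) - plaquetteObs ρ p.1 p.2.1.1 p.2.1.2 U) := fun U => rfl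
  have h1 : ∫ U, F U * wilsonBoundaryAction ρ Λ U ∂(zdHaar d G) =
      ∑ p ∈ plaquettesTouching Λ, ((N : ℝ) * (∫ U, F U ∂(zdHaar d G)) -
        ∫ U, F U * plaquetteObs ρ p.1 p.2.1.1 p.2.1.2 U ∂(zdHaar d G)) := by
    have hre : ∀ U : LGConfig d G, F U * wilsonBoundaryAction ρ Λ U =
        ∑ p ∈ plaquettesTouching Λ, ((N : ℝ) * F U - F U * plaquetteObs ρ p.1 p.2.1.1 p.2.1.2 U) := fun U => by
      rw [hW, Finset.mul_sum]; exact Finset.sum_congr rfl fun p _ => by ring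
    simp_rw [hre]
    rw [integral_finsetSum _ fun p _ => (hI ((continuous_const.mul hFc).sub (hFc.mul (hobs p))) :
      Integrable (fun U : LGConfig d G => (N : ℝ) * F U - F U * plaquetteObs ρ p.1 p.2.1.1 p.2.1.2 U) (zdHaar d G))]
    refine Finset.sum_congr rfl fun p _ => ?_
    have hA : Integrable (fun U : LGConfig d G => (N : ℝ) * F U) (zdHaar d G) := hI (continuous_const.mul hFc)
    have hB : Integrable (fun U : LGConfig d G => F U * plaquetteObs ρ p.1 p.2.1.1 p.2.1.2 U) (zdHaar d G) :=
      hI (hFc.mul (hobs p))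
    rw [integral_sub hA hB, integral_const_mul]
  have h2 : ∫ U, wilsonBoundaryAction ρ Λ U ∂(zdHaar d G) =
      ∑ p ∈ plaquettesTouching Λ, ((N : ℝ) - ∫ U, plaquetteObs ρ p.1 p.2.1.1 p.2.1.2 U ∂(zdHaar d G)) := by
    simp_rw [hW]
    rw [integral_finsetSum _ fun p _ => (hI (continuous_const.sub (hobs p)) :
      Integrable (fun U : LGConfig d G => (N : ℝ) - plaquetteObs ρ p.1 p.2.1.1 p.2.1.2 U) (zdHaar d G))]
    refine Finset.sum_congr rfl fun p _ => ?_
    have hB : Integrable (fun U : LGConfig d G => plaquetteObs ρ p.1 p.2.1.1 p.2.1.2 U) (zdHaar d G) := hI (hobs p)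
    rw [integral_sub (integrable_const _) hB, integral_const, probReal_univ, one_smul]
  rw [h1, h2, Finset.mul_sum, ← Finset.sum_sub_distrib, ← Finset.sum_neg_distrib]
  exact Finset.sum_congr rfl fun p _ => by ring

/-- ★ **Fluctuation–response at `β = 0`, plaquette-sum form**: along any family of DLR states,
`d/dβ|₀ ∫F dν_β = Σ_{p ∩ Λ ≠ ∅} Cov_{dg_∞}(F, Re tr ρ(U_p))` — the first-order strong-coupling (Balian–Drouffe–Itzykson)
coefficient of every local observable, for every compact gauge group. [folklore] -/
theorem hasDerivAt_integral_cylinder_zero_sum (hρ : Continuous ρ) {Λ : Finset (ZdEdge d)} {F : LGConfig d G → ℝ}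
    (hFΛ : IsCylinder F Λ) (hFc : Continuous F) {ν : ℝ → Measure (LGConfig d G)}
    (hν : ∀ᶠ β in 𝓝 0, ν β ∈ ymGibbsMeasures (d := d) ρ β) :
    HasDerivAt (fun β => ∫ U, F U ∂(ν β))
      (∑ p ∈ plaquettesTouching Λ, ((∫ U, F U * plaquetteObs ρ p.1 p.2.1.1 p.2.1.2 U ∂(zdHaar d G)) -
        (∫ U, F U ∂(zdHaar d G)) * ∫ U, plaquetteObs ρ p.1 p.2.1.1 p.2.1.2 U ∂(zdHaar d G))) 0 := by
  rw [← cov_wilsonBoundaryAction_zdHaar_eq_sum ρ hρ Λ hFc]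
  exact hasDerivAt_integral_cylinder_zero ρ hρ hFΛ hFc hν

end Cylinder

end Summit.Ventures.YMGap.ZeroCouplingSlope
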